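import Literature.Analysis.FluidPDE.JiaSverak2014BootstrapBase
import Literature.Analysis.FluidPDE.JiaSverak2014DerivativeGain
import Literature.Analysis.FluidPDE.OseenSliceHolder
import HarnessLib

/-!
# Jia–Šverák 2014, local higher regularity: all levels of the derivative bootstrap

Analysis/FluidPDE proofs file (theorems only; no definitions, no named facts), part of the proof
of the named fact `Literature.Analysis.FluidPDE.jia_sverak_2014_local_higher_regularity`
(`JiaSverak2014LocalRegularity.lean`; H. Jia, V. Šverák, Invent. Math. 196 (2014) =
arXiv:1204.0529, §3 Thm 3.2 and the bootstrap remark after its proof, p. 9; §4 proof of Thm 4.1: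
"we can apply Theorem 3.1 and some simple bootstrapping arguments"). The induction over the
levels: starting from the Hölder continuous representative (`base_level`) and gaining one
derivative per step on the shrinking balls `B(x₀, ρₙ)`, `ρₙ = 1/8 + 2⁻ⁿ/16`
(`level_step`), for every `n` there is a universal constant `Cₙ` and, for every solution in the
standing situation, a level-`n` representative `R` of `u` on `(0, T_b) × B(x₀, ρₙ)` with
`R(t) ∈ C^{n,γ}` (one-constant class `IsHolderField n γ Cₙ`) for all `t`.

* `levelRadius_facts` — `1/8 < ρₙ₊₁ < ρₙ ≤ 3/16`;
* `all_levels` — the statement above.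

## References

* H. Jia, V. Šverák, Invent. Math. 196 (2014) = arXiv:1204.0529, §3 p. 9, §4. Bib key
  `JiaSverak2014`.
-/

noncomputable section

open MeasureTheory TopologicalSpace Set Function Filter Metric
open _root_.Topology
open scoped ENNReal NNReal RealInnerProductSpace Laplacian

namespace Literature.Analysis.FluidPDE

namespace JiaSverak2014

open Literature.Analysis.UnboundedOperators LemarieRieusset2016

/-- The radii `ρₙ = 1/8 + 2⁻ⁿ/16`: `ρ₀ = 3/16`, `1/8 < ρₙ₊₁ < ρₙ ≤ 3/16`. [folklore] -/
theorem levelRadius_facts (n : ℕ) :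
    (1 / 8 : ℝ) < 1 / 8 + (1 / 2) ^ (n + 1) / 16 ∧
      (1 / 8 : ℝ) + (1 / 2) ^ (n + 1) / 16 < 1 / 8 + (1 / 2) ^ n / 16 ∧
      (1 / 8 : ℝ) + (1 / 2) ^ n / 16 ≤ 3 / 16 := by
  have h1 : (0 : ℝ) < (1 / 2) ^ (n + 1) := by positivity
  have h2 : ((1 : ℝ) / 2) ^ (n + 1) < (1 / 2) ^ n := by
    rw [pow_succ]; nlinarith [pow_pos (show (0 : ℝ) < 1 / 2 by norm_num) n]
  have h3 : ((1 : ℝ) / 2) ^ n ≤ 1 := pow_le_one₀ (by norm_num) (by norm_num)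
  refine ⟨by linarith, by linarith, by linarith⟩

set_option maxHeartbeats 1600000 in
/-- **All levels of the bootstrap.** For `M`, `0 < γ < 1`, `K_b ≥ 0`, `α_u` and datum bounds
`A_d ≥ 0`: for every `n` there is `Cₙ ≥ 0` such that for every local Leray solution `(u,p)` on
`(0,T') × ℝ³` (measurable datum, `|u₀| ≤ M` and `(M,γ)`-Hölderian on `B(x₀,2)`, smooth on
`B(x₀,1)` with `‖Dᵏu₀‖ ≤ A_d k` there), `0 < T_b < T_b' ≤ T'`, `T_b' ≤ 1`, `|u| ≤ K_b` a.e. on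
`(0,T_b') × B(x₀,7/12)`, uniformly local energy `≤ α_u`, there is `R : ℝ → ℝ³ → ℝ³`, jointly
strongly measurable, with `R(t) ∈ C^{n,γ}` (constant `Cₙ`) for every `t` and `R(t) = u(t)`
a.e. on `B(x₀, ρₙ)` for a.e. `t ∈ (0,T_b)`, `ρₙ = 1/8 + 2⁻ⁿ/16`.
[cite: JiaSverak2014, §3 proof of Thm. 3.2 (arXiv p. 9), §4 proof of Thm. 4.1] -/
theorem all_levels (M γ : ℝ≥0) (hγ0 : 0 < (γ : ℝ)) (hγ1 : (γ : ℝ) < 1) {Kb : ℝ} (hKb : 0 ≤ Kb) (αu : ℝ≥0)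
    {Ad : ℕ → ℝ} (hAd0 : ∀ k, 0 ≤ Ad k) (n : ℕ) :
    ∃ C : ℝ, 0 ≤ C ∧ ∀ {T' : ℝ} {x₀ : EuclideanSpace ℝ (Fin 3)}
      {u₀ : (EuclideanSpace ℝ (Fin 3)) → (EuclideanSpace ℝ (Fin 3))}
      {u : ℝ → (EuclideanSpace ℝ (Fin 3)) → (EuclideanSpace ℝ (Fin 3))} {p : ℝ → (EuclideanSpace ℝ (Fin 3)) → ℝ}
      {Tb Tb' : ℝ},
      AEStronglyMeasurable u₀ volume → IsLocalLeraySolutionOn T' 1 u₀ u p →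
      0 < Tb → Tb < Tb' → Tb' ≤ T' → Tb' ≤ 1 →
      (∀ x ∈ ball x₀ 2, ‖u₀ x‖ ≤ M) → HolderOnWith M γ u₀ (ball x₀ 2) →
      ContDiffOn ℝ (⊤ : ℕ∞) u₀ (ball x₀ 1) →
      (∀ k, ∀ x ∈ ball x₀ 1, ‖iteratedFDeriv ℝ k u₀ x‖ ≤ Ad k) →
      (∀ᵐ z ∂(volume.restrict (Ioo 0 Tb' ×ˢ ball x₀ (7 / 12))), ‖u z.1 z.2‖ ≤ Kb) →
      (∀ᵐ t ∂(volume.restrict (Ioo 0 T')), ∀ z : EuclideanSpace ℝ (Fin 3), ∫⁻ x in ball z 1, ‖u t x‖ₑ ^ 2 ≤ αu) →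
      ∃ R : ℝ → (EuclideanSpace ℝ (Fin 3)) → (EuclideanSpace ℝ (Fin 3)),
        StronglyMeasurable (uncurry R) ∧ (∀ t, IsHolderField n (γ : ℝ) C (R t)) ∧
        ∀ᵐ t ∂(volume.restrict (Ioo 0 Tb)), ∀ᵐ x ∂(volume.restrict (ball x₀ (1 / 8 + (1 / 2) ^ n / 16))), R t x = u t x := by
  induction n with
  | zero =>
    obtain ⟨𝒞₀, h𝒞₀, hbase⟩ := base_level M γ hγ0 hγ1 hKb αu
    refine ⟨𝒞₀, h𝒞₀, ?_⟩
    intro T' x₀ u₀ u p Tb Tb' hm₀ hu hTb hTbTb' hTb'T' hTb'1 hM hH hu₀ hAd hbd hαu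
    obtain ⟨R, hRm, hR0, hRb, hRH, -, hRu⟩ := hbase hm₀ hu hTb hTbTb' hTb'T' hTb'1 hM hH hbd hαu
    refine ⟨R, hRm, fun t => ⟨hR0 t, hRb t, hRH t⟩, ?_⟩
    have e : (1 / 8 : ℝ) + (1 / 2) ^ 0 / 16 = 3 / 16 := by norm_num
    rw [e]; exact hRu
  | succ n ih =>
    obtain ⟨C, hC0, hlev⟩ := ih
    obtain ⟨h1, h2, h3⟩ := levelRadius_facts n
    obtain ⟨C', hC'0, hstep⟩ := level_step n hγ0 hγ1 (ρ' := 1 / 8 + (1 / 2) ^ (n + 1) / 16)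
      (ρ := 1 / 8 + (1 / 2) ^ n / 16) (by linarith) h2 (h3.trans (by norm_num)) hKb αu hAd0 hC0
    refine ⟨C', hC'0, ?_⟩
    intro T' x₀ u₀ u p Tb Tb' hm₀ hu hTb hTbTb' hTb'T' hTb'1 hM hH hu₀ hAd hbd hαu
    obtain ⟨R, hRm, hRH, hRu⟩ := hlev hm₀ hu hTb hTbTb' hTb'T' hTb'1 hM hH hu₀ hAd hbd hαu
    obtain ⟨R', hR'm, hR'n, hR'b, hR'H, hR'u⟩ := hstep hm₀ hu hTb hTbTb' hTb'T' hTb'1 hu₀ hAd hbd hαu R hRm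
      (fun t => (hRH t).contDiff) (fun t => (hRH t).norm_le) (fun t => (hRH t).holder) hRu
    exact ⟨R', hR'm, fun t => ⟨hR'n t, hR'b t, hR'H t⟩, hR'u⟩

end JiaSverak2014

end Literature.Analysis.FluidPDE
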